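import Mathlib
import HarnessLib

/-!
# Teräväinen 2024, Lemma 5.7: maximizing an exponential sum

Support file (everything PROVED; no definitions, no named facts) towards the named fact
`Literature.NumberTheory.Sieve.teravainen2024_cor_2_1` (J. Teräväinen, *On the Liouville function
at polynomial arguments*, Amer. J. Math. 146 (2024) = arXiv:2010.07924, Corollary 2.1), whose
printed proof is the special case `g_j = λ` of Theorem 2.6 there (§5). Step 4 of that proof
(§5.4, Proposition 5.4, the minor-arc case) rests on the following elementary extremal inequality
for exponential sums, printed as

> **Lemma 5.7** (Maximizing an exponential sum). Let `1 ≤ m ≤ n` be integers, and let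
> `w_j ∈ [0,1]` be real numbers for `1 ≤ j ≤ n` with `∑_{1 ≤ j ≤ n} w_j = m`. Then
> `|∑_{1 ≤ j ≤ n} w_j e(j/n)| ≤ |∑_{1 ≤ j ≤ m} e(j/n)|`.

(`e(x) = exp(2πix)`.) This file proves it (`Teravainen2024.lemma_5_7`, with the hypothesis
`1 ≤ m` dropped — the case `m = 0` is trivial), in the slightly more flexible forms actually used
in §5.4: weights indexed by any window `(a, a+n]` of integers
(`Teravainen2024.norm_sum_Ioc_weight_mul_exp_le`) or by `0 ≤ j < n`
(`Teravainen2024.norm_sum_range_weight_mul_exp_le`), with the maximizer written as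
`∑_{0 ≤ i < m} e(i/n)` (same modulus as `∑_{1 ≤ j ≤ m} e(j/n)`,
`Teravainen2024.norm_sum_Icc_exp_eq_norm_sum_range`), together with its closed form
`|∑_{0 ≤ i < m} e(i/n)| = sin(πm/n) / sin(π/n)` for `n ≥ 2`
(`Teravainen2024.norm_sum_range_exp_eq`). The printed equality clause ("equality holds iff, after
a cyclic permutation of the indices, `w_i = 1` for `i ≤ m` and `w_i = 0` for `m < i ≤ n`") is not
used in the paper's argument and is not formalized here.

## Proof

The printed proof ("rotate so that the sum is non-negative; the `m` largest values of
`cos(2π(j/n + θ))`, `j ∈ ℤ_n`, are attained on an interval of `ℤ_n` of length `m`; rearrangement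
inequality") is followed, with the rearrangement step replaced by the equivalent one-line
"bathtub" exchange argument (`Teravainen2024.sum_mul_le_sum_of_threshold`: if `0 ≤ w ≤ 1`,
`∑ w = #I`, and `c ≥ τ` on `I`, `c ≤ τ` off `I`, then `∑ w c ≤ ∑_I c`), and the "interval of the
`m` largest values" made explicit (`Teravainen2024.exists_topArc`: for the profile
`c(j) = cos(2π(j - t)/n)` the window of the `m` consecutive integers starting at `⌈t - m/2⌉`
dominates every integer none of whose translates by multiples of `n` lies in the window).

## References
* J. Teräväinen, Amer. J. Math. 146 (2024), no. 4, 1115–1167, §5.4, Lemma 5.7 (arXiv:2010.07924,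
  p. 15). [Teravainen2024]
-/

noncomputable section

open Finset Complex

namespace Literature.NumberTheory.Sieve

namespace Teravainen2024

/-! ### Two monotonicity facts for the cosine -/

/-- `cos` is even and decreasing on `[0, π]`: `|x| ≤ y ≤ π ⟹ cos y ≤ cos x`. [folklore] -/
theorem cos_le_cos_of_abs_le {x y : ℝ} (hxy : |x| ≤ y) (hy : y ≤ Real.pi) :
    Real.cos y ≤ Real.cos x := by
  rw [← Real.cos_abs x]
  exact Real.cos_le_cos_of_nonneg_of_le_pi (abs_nonneg x) hy hxy

/-- `cos` is even and decreasing on `[0, π]`: `0 ≤ a ≤ |x| ≤ π ⟹ cos x ≤ cos a`. [folklore] -/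
theorem cos_le_cos_of_le_abs {x a : ℝ} (ha : 0 ≤ a) (hax : a ≤ |x|) (hx : |x| ≤ Real.pi) :
    Real.cos x ≤ Real.cos a := by
  rw [← Real.cos_abs x]
  exact Real.cos_le_cos_of_nonneg_of_le_pi ha hx hax

/-! ### The exchange ("bathtub") inequality -/

/-- **Bathtub / exchange inequality.** If `0 ≤ w ≤ 1` on `s`, `∑_s w = #I` for some `I ⊆ s`, and a
profile `c` is `≥ τ` on `I` and `≤ τ` on `s ∖ I`, then `∑_s w·c ≤ ∑_I c`: concentrating the total
mass `#I` on the set of the `#I` largest values of `c` can only increase the weighted sum. (This is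
the rearrangement step of the printed proof of Lemma 5.7.) [cite: Teravainen2024, proof of
Lemma 5.7] -/
theorem sum_mul_le_sum_of_threshold {ι : Type*} [DecidableEq ι] {s I : Finset ι} (hI : I ⊆ s)
    {w c : ι → ℝ} {τ : ℝ} (hw0 : ∀ i ∈ s, 0 ≤ w i) (hw1 : ∀ i ∈ s, w i ≤ 1)
    (hsum : ∑ i ∈ s, w i = #I) (hcI : ∀ i ∈ I, τ ≤ c i) (hcs : ∀ i ∈ s, i ∉ I → c i ≤ τ) :
    ∑ i ∈ s, w i * c i ≤ ∑ i ∈ I, c i := by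
  have hsplit : ∑ i ∈ s \ I, w i * c i + ∑ i ∈ I, w i * c i = ∑ i ∈ s, w i * c i :=
    Finset.sum_sdiff hI
  have hsplitw : ∑ i ∈ s \ I, w i + ∑ i ∈ I, w i = ∑ i ∈ s, w i := Finset.sum_sdiff hI
  have h1 : ∑ i ∈ s \ I, w i * c i ≤ (∑ i ∈ s \ I, w i) * τ := by
    rw [Finset.sum_mul]
    refine Finset.sum_le_sum fun i hi => ?_
    rw [Finset.mem_sdiff] at hi
    exact mul_le_mul_of_nonneg_left (hcs i hi.1 hi.2) (hw0 i hi.1)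
  have h2 : ∑ i ∈ I, w i * c i + (∑ i ∈ I, (1 - w i)) * τ ≤ ∑ i ∈ I, c i := by
    rw [Finset.sum_mul, ← Finset.sum_add_distrib]
    refine Finset.sum_le_sum fun i hi => ?_
    have h3 := hcI i hi
    have h4 := hw1 i (hI hi)
    nlinarith
  have h3 : ∑ i ∈ s \ I, w i = ∑ i ∈ I, (1 - w i) := by
    rw [Finset.sum_sub_distrib]
    simp only [Finset.sum_const, nsmul_eq_mul, mul_one]
    linarith
  calc ∑ i ∈ s, w i * c i = ∑ i ∈ s \ I, w i * c i + ∑ i ∈ I, w i * c i := hsplit.symm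
    _ ≤ (∑ i ∈ s \ I, w i) * τ + ∑ i ∈ I, w i * c i := by linarith
    _ = ∑ i ∈ I, w i * c i + (∑ i ∈ I, (1 - w i)) * τ := by rw [h3]; ring
    _ ≤ ∑ i ∈ I, c i := h2

/-! ### The `m` largest values of `cos(2π(j-t)/n)` sit on an arc -/

/-- **The top arc.** For the profile `c(j) = cos(2π(j - t)/n)` on the integers (`n ≥ 1`,
`t ∈ ℝ`, `1 ≤ m ≤ n`) there are an integer `A` (namely `⌈t - m/2⌉`) and a threshold `τ` such that
`c ≥ τ` on the window `A, A+1, …, A+m-1`, while `c(j) ≤ τ` for every integer `j` none of whose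
translates `j + qn` lies in that window ("the `m` largest values of `cos(2π(j/n + θ))` with
`j ∈ ℤ_n` are attained for `j` in some interval of `ℤ_n` of length `m`").
[cite: Teravainen2024, proof of Lemma 5.7] -/
theorem exists_topArc {n : ℕ} (hn : 0 < n) (t : ℝ) {m : ℕ} (hm1 : 1 ≤ m) (hmn : m ≤ n) :
    ∃ (A : ℤ) (τ : ℝ),
      (∀ i : ℕ, i < m → τ ≤ Real.cos (2 * Real.pi * (((A : ℝ) + i) - t) / n)) ∧
      (∀ j : ℤ, (∀ q : ℤ, ∀ i : ℕ, i < m → j + q * n ≠ A + i) →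
        Real.cos (2 * Real.pi * ((j : ℝ) - t) / n) ≤ τ) := by
  have hnR : (0 : ℝ) < n := by exact_mod_cast hn
  have hmR : (1 : ℝ) ≤ m := by exact_mod_cast hm1
  have hmnR : (m : ℝ) ≤ n := by exact_mod_cast hmn
  have hπ := Real.pi_pos
  set A : ℤ := ⌈t - m / 2⌉ with hA
  have hA1 : t - m / 2 ≤ A := Int.le_ceil _
  have hA2 : (A : ℝ) < t - m / 2 + 1 := Int.ceil_lt_add_one _
  set r : ℝ := max (t - A) (A + m - 1 - t) with hr
  have hr0 : 0 ≤ r := by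
    rcases le_total 0 (t - A) with h | h
    · exact le_max_of_le_left h
    · exact le_max_of_le_right (by linarith)
  have hrn : r ≤ n / 2 := max_le (by linarith) (by linarith)
  have hr1 : r ≤ t - A + 1 := max_le (by linarith) (by linarith)
  have hr2 : r ≤ A + m - t := max_le (by linarith) (by linarith)
  have h2π : (0 : ℝ) < 2 * Real.pi := by positivity
  have hscale : ∀ {u v : ℝ}, u ≤ v →
      2 * Real.pi * u / n ≤ 2 * Real.pi * v / n := fun huv =>
    div_le_div_of_nonneg_right (mul_le_mul_of_nonneg_left huv h2π.le) hnR.le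
  have habs_scale : ∀ u : ℝ, |2 * Real.pi * u / n| = 2 * Real.pi * |u| / n := fun u => by
    rw [abs_div, abs_mul, abs_of_pos h2π, abs_of_pos hnR]
  have hrπ : 2 * Real.pi * r / n ≤ Real.pi := by
    rw [div_le_iff₀ hnR]; nlinarith
  refine ⟨A, Real.cos (2 * Real.pi * r / n), fun i hi => ?_, fun j hj => ?_⟩
  · -- on the window: `|A + i - t| ≤ r ≤ n/2`
    apply cos_le_cos_of_abs_le _ hrπ
    have hi' : (i : ℝ) ≤ m - 1 := by
      have h : i + 1 ≤ m := hi
      have h' : ((i + 1 : ℕ) : ℝ) ≤ m := by exact_mod_cast h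
      push_cast at h'
      linarith
    have habs : |(A : ℝ) + i - t| ≤ r := by
      rw [abs_le]
      constructor
      · have h1 : t - A ≤ r := le_max_left _ _
        have h2 : (0 : ℝ) ≤ i := Nat.cast_nonneg i
        linarith
      · have h1 : (A : ℝ) + m - 1 - t ≤ r := le_max_right _ _
        linarith
    rw [habs_scale]
    exact hscale habs
  · -- off the window (mod `n`): reduce `j` into `[t - n/2, t + n/2)`
    set y : ℝ := toIcoMod hnR (t - n / 2) (j : ℝ) with hy
    set k : ℤ := toIcoDiv hnR (t - n / 2) (j : ℝ) with hk
    have hyk : (j : ℝ) - k * (n : ℝ) = y := by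
      rw [← zsmul_eq_mul]
      exact self_sub_toIcoDiv_zsmul hnR (t - n / 2) (j : ℝ)
    obtain ⟨hy1, hy2⟩ := toIcoMod_mem_Ico hnR (t - n / 2) (j : ℝ)
    rw [← hy] at hy1 hy2
    obtain ⟨j', hj'⟩ : ∃ j' : ℤ, j' = j - k * n := ⟨_, rfl⟩
    have hj'R : (j' : ℝ) = y := by rw [hj']; push_cast; linarith
    have hry : r ≤ |y - t| := by
      by_contra hlt
      rw [not_le, abs_lt] at hlt
      have hlow : ((A - 1 : ℤ) : ℝ) < j' := by push_cast; linarith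
      have hup : (j' : ℝ) < ((A + m : ℤ) : ℝ) := by push_cast; linarith
      have hlow' : A - 1 < j' := Int.cast_lt.mp hlow
      have hup' : j' < A + m := Int.cast_lt.mp hup
      obtain ⟨i, hi⟩ : ∃ i : ℕ, (i : ℤ) = j' - A := ⟨(j' - A).toNat, Int.toNat_of_nonneg (by omega)⟩
      have him : i < m := by omega
      exact hj (-k) i him (by rw [neg_mul]; linear_combination -hj' - hi)
    have hyt : |y - t| ≤ n / 2 := by
      rw [abs_le]
      constructor <;> linarith
    have hcos : Real.cos (2 * Real.pi * (y - t) / n) ≤ Real.cos (2 * Real.pi * r / n) := by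
      apply cos_le_cos_of_le_abs (by positivity)
      · rw [habs_scale]
        exact hscale hry
      · rw [habs_scale, div_le_iff₀ hnR]
        nlinarith
    have hper : Real.cos (2 * Real.pi * ((j : ℝ) - t) / n) =
        Real.cos (2 * Real.pi * (y - t) / n) := by
      have h : 2 * Real.pi * ((j : ℝ) - t) / n =
          2 * Real.pi * (y - t) / n + k * (2 * Real.pi) := by
        rw [← hyk]
        field_simp
        ring
      rw [h, Real.cos_add_int_mul_two_pi]
    rw [hper]
    exact hcos

/-! ### Rotation -/

/-- Every complex number is rotated onto the non-negative real axis by some `e^{iθ}`.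
[folklore] -/
theorem exists_rot_eq_norm (S : ℂ) : ∃ θ : ℝ, exp (θ * I) * S = (‖S‖ : ℂ) := by
  by_cases hS : S = 0
  · exact ⟨0, by simp [hS]⟩
  · refine ⟨-S.arg, ?_⟩
    have h := Complex.norm_mul_exp_arg_mul_I S
    calc exp (((-S.arg : ℝ) : ℂ) * I) * S
        = exp (((-S.arg : ℝ) : ℂ) * I) * (‖S‖ * exp (S.arg * I)) := by rw [h]
      _ = ‖S‖ * exp (((-S.arg : ℝ) : ℂ) * I + S.arg * I) := by rw [Complex.exp_add]; ring
      _ = ‖S‖ := by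
        have h0 : ((-S.arg : ℝ) : ℂ) * I + S.arg * I = 0 := by push_cast; ring
        rw [h0, Complex.exp_zero, mul_one]

/-! ### Geometric facts about `∑ e(i/n)` over windows -/

/-- Translating a window of `m` consecutive integers does not change `|∑ e(j/n)|`:
`|∑_{i<m} e((A+i)/n)| = |∑_{i<m} e(i/n)|`. [folklore] -/
theorem norm_sum_range_exp_shift (n : ℕ) (A : ℤ) (m : ℕ) :
    ‖∑ i ∈ range m, exp (2 * Real.pi * I * (((A : ℝ) + i : ℝ) : ℂ) / n)‖ =
      ‖∑ i ∈ range m, exp (2 * Real.pi * I * (i : ℂ) / n)‖ := by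
  have h : ∑ i ∈ range m, exp (2 * Real.pi * I * (((A : ℝ) + i : ℝ) : ℂ) / n) =
      exp (2 * Real.pi * I * (A : ℂ) / n) * ∑ i ∈ range m, exp (2 * Real.pi * I * (i : ℂ) / n) := by
    rw [Finset.mul_sum]
    refine Finset.sum_congr rfl fun i _ => ?_
    rw [← Complex.exp_add]
    congr 1
    push_cast
    ring
  rw [h, norm_mul]
  have h1 : ‖exp (2 * Real.pi * I * (A : ℂ) / n)‖ = 1 := by
    have : 2 * Real.pi * I * (A : ℂ) / n = ((2 * Real.pi * A / n : ℝ) : ℂ) * I := by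
      push_cast
      ring
    rw [this, Complex.norm_exp_ofReal_mul_I]
  rw [h1, one_mul]

/-- `|∑_{1 ≤ j ≤ m} e(j/n)| = |∑_{0 ≤ i < m} e(i/n)|` (the printed maximizer versus the one used
below). [folklore] -/
theorem norm_sum_Icc_exp_eq_norm_sum_range (n m : ℕ) :
    ‖∑ j ∈ Icc (1 : ℤ) m, exp (2 * Real.pi * I * (j : ℂ) / n)‖ =
      ‖∑ i ∈ range m, exp (2 * Real.pi * I * (i : ℂ) / n)‖ := by
  have himage : (range m).image (fun i : ℕ => (1 : ℤ) + i) = Icc (1 : ℤ) m := by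
    ext x
    simp only [Finset.mem_image, Finset.mem_range, Finset.mem_Icc]
    constructor
    · rintro ⟨i, hi, rfl⟩
      omega
    · rintro ⟨h1, h2⟩
      exact ⟨(x - 1).toNat, by omega, by omega⟩
  have hinj : Set.InjOn (fun i : ℕ => (1 : ℤ) + i) (range m : Set ℕ) := by
    intro i _ i' _ h
    simpa using h
  rw [← himage, Finset.sum_image hinj]
  have h := norm_sum_range_exp_shift n 1 m
  push_cast at h ⊢
  exact h

/-- **Closed form of the maximizer**: for `n ≥ 2` and `m ≤ n`,
`|∑_{0 ≤ i < m} e(i/n)| = sin(πm/n) / sin(π/n)`. [folklore] -/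
theorem norm_sum_range_exp_eq {n m : ℕ} (hn : 2 ≤ n) (hmn : m ≤ n) :
    ‖∑ i ∈ range m, exp (2 * Real.pi * I * (i : ℂ) / n)‖ =
      Real.sin (Real.pi * m / n) / Real.sin (Real.pi / n) := by
  have h2n : (2 : ℝ) ≤ n := by exact_mod_cast hn
  have hnR : (0 : ℝ) < n := by linarith
  have hπ := Real.pi_pos
  set x : ℂ := exp (2 * Real.pi * I / n) with hx
  have hterm : ∀ i : ℕ, exp (2 * Real.pi * I * (i : ℂ) / n) = x ^ i := fun i => by
    rw [hx, ← Complex.exp_nat_mul]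
    congr 1
    ring
  -- `|e(u) - 1| = 2 |sin(π u)|`
  have hchord : ∀ u : ℝ, ‖exp (2 * Real.pi * I * u) - 1‖ = 2 * |Real.sin (Real.pi * u)| := by
    intro u
    have h1 : exp (2 * Real.pi * I * u) - 1 =
        exp (Real.pi * u * I) * (exp (Real.pi * u * I) - exp (-(Real.pi * u * I))) := by
      rw [mul_sub, ← Complex.exp_add, ← Complex.exp_add]
      have : (Real.pi : ℂ) * u * I + Real.pi * u * I = 2 * Real.pi * I * u := by ring
      rw [this, add_neg_cancel, Complex.exp_zero]
    have h2 : exp (Real.pi * u * I) - exp (-(Real.pi * u * I)) =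
        2 * I * Complex.sin (Real.pi * u) := by
      rw [Complex.sin]
      have hI : (2 : ℂ) * I * ((exp (-(↑Real.pi * ↑u) * I) - exp (↑Real.pi * ↑u * I)) * I / 2)
          = -(I * I) * (exp (↑Real.pi * ↑u * I) - exp (-(↑Real.pi * ↑u) * I)) := by ring
      rw [hI, Complex.I_mul_I]
      ring_nf
    rw [h1, norm_mul, h2]
    have h3 : ‖exp ((Real.pi : ℂ) * u * I)‖ = 1 := by
      have : (Real.pi : ℂ) * u * I = ((Real.pi * u : ℝ) : ℂ) * I := by push_cast; ring
      rw [this, Complex.norm_exp_ofReal_mul_I]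
    rw [h3, one_mul, norm_mul, norm_mul, Complex.norm_I, mul_one]
    have h4 : Complex.sin (↑Real.pi * ↑u) = ((Real.sin (Real.pi * u) : ℝ) : ℂ) := by
      rw [Complex.ofReal_sin]
      push_cast
      ring_nf
    rw [h4, Complex.norm_real, Real.norm_eq_abs]
    norm_num
  have hsin_pos : 0 < Real.sin (Real.pi / n) := by
    apply Real.sin_pos_of_pos_of_lt_pi (by positivity)
    rw [div_lt_iff₀ hnR]
    have : (2 : ℝ) ≤ n := by exact_mod_cast hn
    nlinarith
  have hden : ‖x - 1‖ = 2 * Real.sin (Real.pi / n) := by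
    have h : x = exp (2 * Real.pi * I * ((1 / n : ℝ) : ℂ)) := by
      rw [hx]
      congr 1
      push_cast
      ring
    rw [h, hchord, abs_of_nonneg, mul_one_div]
    rw [mul_one_div]
    exact hsin_pos.le
  have hx1 : x ≠ 1 := by
    intro h
    have h' : ‖x - 1‖ = 0 := by rw [h]; simp
    rw [hden] at h'
    linarith
  have hsum : ∑ i ∈ range m, exp (2 * Real.pi * I * (i : ℂ) / n) = (x ^ m - 1) / (x - 1) := by
    rw [Finset.sum_congr rfl fun i _ => hterm i]
    exact geom_sum_eq hx1 m
  rw [hsum, norm_div]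
  have hnum : ‖x ^ m - 1‖ = 2 * Real.sin (Real.pi * m / n) := by
    have h : x ^ m = exp (2 * Real.pi * I * ((m / n : ℝ) : ℂ)) := by
      rw [← hterm m]
      congr 1
      push_cast
      ring
    rw [h, hchord, abs_of_nonneg, mul_div_assoc]
    apply Real.sin_nonneg_of_nonneg_of_le_pi (by positivity)
    have h1 : (m : ℝ) / n ≤ 1 := by rw [div_le_one hnR]; exact_mod_cast hmn
    nlinarith
  rw [hnum, hden]
  field_simp

/-! ### Lemma 5.7 -/

/-- **Teräväinen 2024, Lemma 5.7, window form.** Let `n ≥ 1`, `0 ≤ m ≤ n`, and let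
`w_j ∈ [0, 1]` for the integers `j` of a window `a < j ≤ a + n`, with `∑_j w_j = m`. Then
`|∑_{a<j≤a+n} w_j e(j/n)| ≤ |∑_{0≤i<m} e(i/n)|` (`= |∑_{1≤j≤m} e(j/n)|`,
`Teravainen2024.norm_sum_Icc_exp_eq_norm_sum_range`). [cite: Teravainen2024, Lemma 5.7] -/
theorem norm_sum_Ioc_weight_mul_exp_le {n : ℕ} (hn : 0 < n) (a : ℤ) {m : ℕ} (hmn : m ≤ n)
    (w : ℤ → ℝ) (hw0 : ∀ j ∈ Ioc a (a + n), 0 ≤ w j) (hw1 : ∀ j ∈ Ioc a (a + n), w j ≤ 1)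
    (hsum : ∑ j ∈ Ioc a (a + n), w j = m) :
    ‖∑ j ∈ Ioc a (a + n), (w j : ℂ) * exp (2 * Real.pi * I * (j : ℂ) / n)‖ ≤
      ‖∑ i ∈ range m, exp (2 * Real.pi * I * (i : ℂ) / n)‖ := by
  rcases Nat.eq_zero_or_pos m with rfl | hm1
  · -- all the weights vanish
    have hw : ∀ j ∈ Ioc a (a + n), w j = 0 :=
      (Finset.sum_eq_zero_iff_of_nonneg hw0).mp (by simpa using hsum)
    rw [Finset.sum_eq_zero fun j hj => by rw [hw j hj]; simp]
    simp
  have hnR : (0 : ℝ) < n := by exact_mod_cast hn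
  have hπ := Real.pi_pos
  set S : ℂ := ∑ j ∈ Ioc a (a + n), (w j : ℂ) * exp (2 * Real.pi * I * (j : ℂ) / n) with hS
  obtain ⟨θ, hθ⟩ := exists_rot_eq_norm S
  -- the centre `t` of the rotated profile: `θ + 2πj/n = 2π(j - t)/n`
  set t : ℝ := -(n * θ) / (2 * Real.pi) with ht
  have hphase : ∀ u : ℝ, θ + 2 * Real.pi * u / n = 2 * Real.pi * (u - t) / n := by
    intro u
    rw [ht]
    field_simp
    ring
  set c : ℤ → ℝ := fun j => Real.cos (2 * Real.pi * ((j : ℝ) - t) / n) with hc_def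
  have hc : ∀ j : ℤ, (exp (θ * I) * exp (2 * Real.pi * I * (j : ℂ) / n)).re = c j := by
    intro j
    rw [hc_def]
    simp only
    rw [← hphase, ← Complex.exp_add]
    have h : (θ : ℂ) * I + 2 * Real.pi * I * (j : ℂ) / n =
        ((θ + 2 * Real.pi * (j : ℝ) / n : ℝ) : ℂ) * I := by
      push_cast
      ring
    rw [h, Complex.exp_ofReal_mul_I_re]
  have hcper : ∀ j k : ℤ, c (j - k * n) = c j := by
    intro j k
    simp only [hc_def]
    have h : 2 * Real.pi * (((j - k * n : ℤ) : ℝ) - t) / n =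
        2 * Real.pi * ((j : ℝ) - t) / n + (-k : ℤ) * (2 * Real.pi) := by
      push_cast
      field_simp
      ring
    rw [h, Real.cos_add_int_mul_two_pi]
  -- `‖S‖ = ∑ w_j c(j)`
  have hnormS : ‖S‖ = ∑ j ∈ Ioc a (a + n), w j * c j := by
    have h1 : ((‖S‖ : ℝ) : ℂ).re = (exp (θ * I) * S).re := by rw [hθ]
    rw [Complex.ofReal_re] at h1
    rw [h1, hS, Finset.mul_sum, Complex.re_sum]
    refine Finset.sum_congr rfl fun j _ => ?_
    rw [← hc j, ← mul_assoc, mul_comm (exp _) (w j : ℂ), mul_assoc, Complex.re_ofReal_mul]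
  -- the top arc for the profile `c`
  obtain ⟨A, τ, hAτ1, hAτ2⟩ := exists_topArc hn t hm1 hmn
  -- reduction of the integers into the window `(a, a + n]`
  have hnZ : (0 : ℤ) < n := by exact_mod_cast hn
  set ρ : ℤ → ℤ := fun j => toIocMod hnZ a j with hρ
  have hρmem : ∀ j, ρ j ∈ Ioc a (a + n) := fun j => by
    have h := toIocMod_mem_Ioc hnZ a j
    rw [Set.mem_Ioc] at h
    rw [Finset.mem_Ioc]
    exact h
  have hρper : ∀ j, ∃ k : ℤ, ρ j = j - k * n := fun j => by
    refine ⟨toIocDiv hnZ a j, ?_⟩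
    have h := self_sub_toIocDiv_zsmul hnZ a j
    simp only [zsmul_eq_mul, Int.cast_id] at h
    exact h.symm
  have hρself : ∀ j ∈ Ioc a (a + n), ρ j = j := fun j hj => by
    apply (toIocMod_eq_self hnZ).mpr
    rw [Finset.mem_Ioc] at hj
    exact hj
  have hρadd : ∀ j q : ℤ, ρ (j + q * n) = ρ j := fun j q => by
    simp only [hρ]
    have h := toIocMod_add_zsmul hnZ a j q
    simp only [zsmul_eq_mul, Int.cast_id] at h
    exact h
  -- the window `J` and its image `Iset` in `(a, a + n]`
  set J : Finset ℤ := (range m).image fun i : ℕ => A + i with hJ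
  have hJmem : ∀ j, j ∈ J ↔ A ≤ j ∧ j < A + m := fun j => by
    rw [hJ, Finset.mem_image]
    constructor
    · rintro ⟨i, hi, rfl⟩
      rw [Finset.mem_range] at hi
      omega
    · rintro ⟨h1, h2⟩
      exact ⟨(j - A).toNat, by rw [Finset.mem_range]; omega, by omega⟩
  have hAinj : Set.InjOn (fun i : ℕ => A + i) (range m : Set ℕ) := fun i _ i' _ h => by
    simpa using h
  have hJinj : Set.InjOn ρ (J : Set ℤ) := by
    intro j hj j' hj' h
    rw [Finset.mem_coe, hJmem] at hj hj'
    obtain ⟨k, hk⟩ := hρper j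
    obtain ⟨k', hk'⟩ := hρper j'
    have h1 : j - j' = (k - k') * n := by rw [hk, hk'] at h; linarith
    have hmnZ : (m : ℤ) ≤ n := by exact_mod_cast hmn
    rcases lt_trichotomy (k - k') 0 with hlt | heq | hgt
    · have : (k - k') * (n : ℤ) ≤ -n := by nlinarith
      omega
    · have : j - j' = 0 := by rw [h1, heq, zero_mul]
      omega
    · have : (n : ℤ) ≤ (k - k') * n := by nlinarith
      omega
  set Iset : Finset ℤ := J.image ρ with hIset
  have hIsub : Iset ⊆ Ioc a (a + n) := by
    intro i hi
    rw [hIset, Finset.mem_image] at hi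
    obtain ⟨j, _, rfl⟩ := hi
    exact hρmem j
  have hcardJ : #J = m := by
    rw [hJ, Finset.card_image_of_injOn hAinj, Finset.card_range]
  have hcardI : #Iset = m := by
    rw [hIset, Finset.card_image_of_injOn hJinj, hcardJ]
  -- the bathtub inequality
  have hbath : ∑ j ∈ Ioc a (a + n), w j * c j ≤ ∑ i ∈ Iset, c i := by
    refine sum_mul_le_sum_of_threshold (τ := τ) hIsub hw0 hw1 (by rw [hsum, hcardI]) ?_ ?_
    · intro i hi
      rw [hIset, Finset.mem_image] at hi
      obtain ⟨j, hj, rfl⟩ := hi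
      obtain ⟨k, hk⟩ := hρper j
      rw [hk, hcper]
      rw [hJ, Finset.mem_image] at hj
      obtain ⟨i₀, hi₀, rfl⟩ := hj
      rw [Finset.mem_range] at hi₀
      have h := hAτ1 i₀ hi₀
      simp only [hc_def]
      push_cast
      exact h
    · intro i hi hiI
      apply hAτ2 i
      intro q i₀ hi₀ heq
      apply hiI
      rw [hIset, Finset.mem_image]
      refine ⟨A + i₀, ?_, ?_⟩
      · rw [hJ, Finset.mem_image]
        exact ⟨i₀, Finset.mem_range.mpr hi₀, rfl⟩
      · rw [← heq, hρadd, hρself i hi]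
  -- `∑_{Iset} c = ∑_{i<m} c(A+i) = Re(e^{iθ} ∑ e((A+i)/n)) ≤ |∑_{i<m} e(i/n)|`
  have hsumI : ∑ i ∈ Iset, c i = ∑ i ∈ range m, c (A + i) := by
    rw [hIset, Finset.sum_image hJinj, hJ, Finset.sum_image hAinj]
    refine Finset.sum_congr rfl fun i _ => ?_
    obtain ⟨k, hk⟩ := hρper (A + i)
    rw [hk, hcper]
  have hre : ∑ i ∈ range m, c (A + i) =
      (exp (θ * I) * ∑ i ∈ range m, exp (2 * Real.pi * I * (((A : ℝ) + i : ℝ) : ℂ) / n)).re := by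
    rw [Finset.mul_sum, Complex.re_sum]
    refine Finset.sum_congr rfl fun i _ => ?_
    rw [← hc (A + i)]
    push_cast
    ring_nf
  calc ‖S‖ = ∑ j ∈ Ioc a (a + n), w j * c j := hnormS
    _ ≤ ∑ i ∈ Iset, c i := hbath
    _ = (exp (θ * I) * ∑ i ∈ range m, exp (2 * Real.pi * I * (((A : ℝ) + i : ℝ) : ℂ) / n)).re := by
        rw [hsumI, hre]
    _ ≤ ‖exp (θ * I) * ∑ i ∈ range m, exp (2 * Real.pi * I * (((A : ℝ) + i : ℝ) : ℂ) / n)‖ :=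
        Complex.re_le_norm _
    _ = ‖∑ i ∈ range m, exp (2 * Real.pi * I * (((A : ℝ) + i : ℝ) : ℂ) / n)‖ := by
        rw [norm_mul, Complex.norm_exp_ofReal_mul_I, one_mul]
    _ = ‖∑ i ∈ range m, exp (2 * Real.pi * I * (i : ℂ) / n)‖ := norm_sum_range_exp_shift n A m

/-- **Teräväinen 2024, Lemma 5.7** (maximizing an exponential sum), as printed (the hypothesis
`1 ≤ m` of the source is not needed): for integers `0 ≤ m ≤ n`, `n ≥ 1`, and reals `w_j ∈ [0,1]`
(`1 ≤ j ≤ n`) with `∑_{1≤j≤n} w_j = m`,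
`|∑_{1≤j≤n} w_j e(j/n)| ≤ |∑_{1≤j≤m} e(j/n)|`, where `e(x) = exp(2πix)`.
[cite: Teravainen2024, Lemma 5.7] -/
theorem lemma_5_7 {n m : ℕ} (hn : 0 < n) (hmn : m ≤ n) (w : ℤ → ℝ)
    (hw0 : ∀ j ∈ Icc (1 : ℤ) n, 0 ≤ w j) (hw1 : ∀ j ∈ Icc (1 : ℤ) n, w j ≤ 1)
    (hsum : ∑ j ∈ Icc (1 : ℤ) n, w j = m) :
    ‖∑ j ∈ Icc (1 : ℤ) n, (w j : ℂ) * exp (2 * Real.pi * I * (j : ℂ) / n)‖ ≤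
      ‖∑ j ∈ Icc (1 : ℤ) m, exp (2 * Real.pi * I * (j : ℂ) / n)‖ := by
  have hwin : Icc (1 : ℤ) n = Ioc (0 : ℤ) (0 + n) := by
    ext j
    simp only [Finset.mem_Icc, Finset.mem_Ioc]
    omega
  rw [norm_sum_Icc_exp_eq_norm_sum_range, hwin]
  rw [hwin] at hw0 hw1 hsum
  exact norm_sum_Ioc_weight_mul_exp_le hn 0 hmn w hw0 hw1 hsum

/-- **Teräväinen 2024, Lemma 5.7, indices `0 ≤ j < n`** (the indexing of its application in
§5.4, where the weights are `α(j)`, `0 ≤ j < J₀`): for `w_i ∈ [0,1]` (`0 ≤ i < n`) with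
`∑ w_i = m ≤ n`, `|∑_{i<n} w_i e(i/n)| ≤ |∑_{i<m} e(i/n)|`. [cite: Teravainen2024, Lemma 5.7] -/
theorem norm_sum_range_weight_mul_exp_le {n m : ℕ} (hn : 0 < n) (hmn : m ≤ n) (w : ℕ → ℝ)
    (hw0 : ∀ i < n, 0 ≤ w i) (hw1 : ∀ i < n, w i ≤ 1) (hsum : ∑ i ∈ range n, w i = m) :
    ‖∑ i ∈ range n, (w i : ℂ) * exp (2 * Real.pi * I * (i : ℂ) / n)‖ ≤
      ‖∑ i ∈ range m, exp (2 * Real.pi * I * (i : ℂ) / n)‖ := by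
  -- transport to the window `(-1, -1 + n]` of integers
  have himage : (range n).image (fun i : ℕ => (i : ℤ)) = Ioc (-1 : ℤ) (-1 + n) := by
    ext x
    simp only [Finset.mem_image, Finset.mem_range, Finset.mem_Ioc]
    constructor
    · rintro ⟨i, hi, rfl⟩
      omega
    · rintro ⟨h1, h2⟩
      exact ⟨x.toNat, by omega, by omega⟩
  have hinj : Set.InjOn (fun i : ℕ => (i : ℤ)) (range n : Set ℕ) := fun i _ i' _ h => by
    simpa using h
  set w' : ℤ → ℝ := fun j => w j.toNat with hw'
  have hw'0 : ∀ j ∈ Ioc (-1 : ℤ) (-1 + n), 0 ≤ w' j := fun j hj => by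
    rw [Finset.mem_Ioc] at hj
    exact hw0 _ (by omega)
  have hw'1 : ∀ j ∈ Ioc (-1 : ℤ) (-1 + n), w' j ≤ 1 := fun j hj => by
    rw [Finset.mem_Ioc] at hj
    exact hw1 _ (by omega)
  have hsum' : ∑ j ∈ Ioc (-1 : ℤ) (-1 + n), w' j = m := by
    rw [← himage, Finset.sum_image hinj, ← hsum]
    refine Finset.sum_congr rfl fun i _ => ?_
    simp [hw']
  have h := norm_sum_Ioc_weight_mul_exp_le hn (-1) hmn w' hw'0 hw'1 hsum'
  rw [← himage, Finset.sum_image hinj] at h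
  have h' : ∑ x ∈ range n, ((w' x : ℝ) : ℂ) * exp (2 * Real.pi * I * ((x : ℤ) : ℂ) / n) =
      ∑ i ∈ range n, (w i : ℂ) * exp (2 * Real.pi * I * (i : ℂ) / n) := by
    refine Finset.sum_congr rfl fun i _ => ?_
    simp [hw']
  rw [h'] at h
  exact h

/-! ### The Jensen step of §5.4 -/

/-- **Jensen step of the minor-arc argument** (Teräväinen 2024, §5.4, display after Lemma 5.7's
application): if `δ_0, …, δ_{q-1} ∈ [0, 1]` sum to `1`, then by concavity of `sin` on `[0, π]`,
`∑_a sin(π δ_a) ≤ q sin(π/q)`. [cite: Teravainen2024, §5.4 (proof of Proposition 5.4, Case 2)] -/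
theorem sum_sin_pi_mul_le {q : ℕ} (hq : 0 < q) (δ : ℕ → ℝ) (h0 : ∀ a < q, 0 ≤ δ a)
    (h1 : ∀ a < q, δ a ≤ 1) (hsum : ∑ a ∈ range q, δ a = 1) :
    ∑ a ∈ range q, Real.sin (Real.pi * δ a) ≤ q * Real.sin (Real.pi / q) := by
  have hqR : (0 : ℝ) < q := by exact_mod_cast hq
  have hπ := Real.pi_pos
  have hconc := (strictConcaveOn_sin_Icc).concaveOn
  have hJ := hconc.le_map_sum (t := range q) (w := fun _ => (1 : ℝ) / q)
    (p := fun a => Real.pi * δ a) (fun _ _ => by positivity)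
    (by rw [Finset.sum_const, Finset.card_range, nsmul_eq_mul]; field_simp)
    (fun a ha => by
      rw [Finset.mem_range] at ha
      exact ⟨by nlinarith [h0 a ha], by nlinarith [h1 a ha]⟩)
  simp only [smul_eq_mul] at hJ
  rw [← Finset.mul_sum, ← Finset.mul_sum] at hJ
  have harg : (1 : ℝ) / q * ∑ a ∈ range q, Real.pi * δ a = Real.pi / q := by
    rw [← Finset.mul_sum, hsum]
    field_simp
  rw [harg] at hJ
  rw [one_div, inv_mul_le_iff₀ hqR] at hJ
  exact hJ

/-- `(q/π) sin(π/q) < 1` for `q ≥ 1` (as `sin x < x` for `x > 0`), so that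
`(1/π) ∑_a sin(π δ_a) ≤ (q/π) sin(π/q) =: 1 - 2δ` with `δ = δ_q > 0` in §5.4.
[cite: Teravainen2024, §5.4 (proof of Proposition 5.4, Case 2)] -/
theorem div_pi_mul_sin_lt_one {q : ℕ} (hq : 0 < q) :
    (q : ℝ) / Real.pi * Real.sin (Real.pi / q) < 1 := by
  have hqR : (0 : ℝ) < q := by exact_mod_cast hq
  have hπ := Real.pi_pos
  have h := Real.sin_lt (by positivity : (0 : ℝ) < Real.pi / q)
  calc (q : ℝ) / Real.pi * Real.sin (Real.pi / q)
      < (q : ℝ) / Real.pi * (Real.pi / q) := mul_lt_mul_of_pos_left h (by positivity)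
    _ = 1 := by field_simp

end Teravainen2024

end Literature.NumberTheory.Sieve
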